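import Literature.Topology.FourManifolds.MMSWRasmussenFacts
import Literature.Topology.FourManifolds.MMSWFibreRotation
import Literature.Topology.FourManifolds.DehnSurgery
import Literature.Topology.FourManifolds.KirbyMoves
import Literature.Topology.FourManifolds.SPC4Wave0Proofs
import Literature.Topology.FourManifolds.TrisectionFunctorSPC4Proofs
import Literature.AlgebraicTopology.SingularHomology.RationalEulerCharacteristic
import Summits.SmoothPoincare4.SmoothPoincare4.Theses.DottedCircleRasmussen
import Summits.SmoothPoincare4.SmoothPoincare4.Theorems.DottedCircleRasmussenDcrGapStubFriendsH2Aux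
import Summits.SmoothPoincare4.SmoothPoincare4.Theorems.DottedCircleRasmussenDcrGapStubFriendsH2Aux4
import Summits.SmoothPoincare4.SmoothPoincare4.Theorems.DottedCircleRasmussenDcrGapStubFriendsH2Aux5

/-!
# Stub `stub_friendsH2` of line `mk_friends` for crux `DcrGap` — reduction to the model handlebody
(item stmt-SmoothPoincare4-16128, route route-SmoothPoincare4-DottedCircleRasmussen)

**The `H₂`-leaf of the friends lemma** (Manolescu–Piccirillo 2023, §3.2, proof of Lemma 3.3: for the
closed `4`-manifold `X = X(K') ∪_Y V` glued from a trace and a slice-disc exterior "it is routine to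
confirm that `X` has the homology type of `W`"; the `k ≥ 1` lift of the line replaces `B⁴` by the
model dotted handlebody `D_k = ♮ᵏ(S¹ × B³)` and `S³` by `#ᵏ(S¹ × S²)`).  In the complement form of
the skeleton: `X` closed smooth simply connected, `i` a germ chart of `D_k`, `f₀` a core disc for
`i ∘ K₀` off `i(D_k)`, `j` a smooth open embedding of the model disc exterior
`E = ℝ⁴ ∖ (D_k ∪ f₁(𝔻²))` onto `X ∖ (i(D_k) ∪ f₀(𝔻²) ∪ {q})`; conclusion `H₂(X; ℤ) = 0`.

PROOF (an Euler-characteristic count; neither null-homology hypothesis is used).  Work with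
`ℚ`-coefficients and write `C⁺ = i(D_k) ∪ f₀(𝔻²) ∪ {q}`, `X ∖ C⁺ = j(E) ≅ E`.  The long exact sequence
of `(X, X ∖ C⁺)` with `H₃(X; ℚ) = H₁(X; ℚ) = 0` (simply connected + Poincaré duality, tree theorems)
gives `b₂(X) = (dim H₂(E) - dim H₁(E)) - (dim H₃(X | C⁺) - dim H₂(X | C⁺))` (`FriendsH2.lesCount`).
Both brackets equal `p₃ - 1 - p₂`, `p_q = dim H_q(ℝ⁴ | D_k; ℚ)`: the second by the relative
Mayer–Vietoris sequence along `C⁺ = i(D_k) ∪ (disc [∪ point])`, meeting in the circle `i(K₀)`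
(`FriendsH2.carrierCount`); the first because `E` is ALSO the complement of such a configuration,
`σD_k ∪ (σf₁(𝔻²) ∪ {N})` in `S⁴` (`σ` the stereographic embedding), where `H₂(S⁴) = 0` in the same
exact sequence (`FriendsH2.sphereCount`).  Hence `b₂(X) = 0`, and `H₂(X; ℤ)`, being free of rank
`b₂(X)` (Kirby 1989 Ch. II §1, tree theorem), vanishes.  The model handlebody enters ONLY through the
finite-dimensionality of `H₂(ℝ⁴ | D_k; ℚ)`, `H₃(ℝ⁴ | D_k; ℚ)` (true values `0`, `k`: Alexander duality
for `D_k ≃ ∨ᵏ S¹`), which is the registered helper `helper_modelHandlebody_localHomology_finite`;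
this file proves the stub GIVEN that helper:

* `helper_friendsH2_of_modelHandlebody_localHomology_finite` — (finiteness of `H_q(ℝ⁴ | D_k; ℚ)`,
  `q = 2, 3`, all `k`) → (signature of `stub_friendsH2`, verbatim).

No `sorry`, no definitions, no named facts.

## References

* C. Manolescu, L. Piccirillo, *From zero surgeries to candidates for exotic definite 4-manifolds*,
  J. Lond. Math. Soc. 108 (2023), §3.2, proof of Lemma 3.3. [ManolescuPiccirillo2023]
* A. Hatcher, *Algebraic Topology*, CUP 2002, Thm. 2.16, §2.2 p. 152, Prop. 2B.1, Thm. 3.30.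
  [HatcherAT2002]
* R. C. Kirby, *The Topology of 4-Manifolds*, LNM 1374, Springer 1989, Ch. II §1. [Kirby1989]
-/

-- the prescribed namespace `Summit.<P>.<Sub>.…` duplicates `SmoothPoincare4` (P = Sub)
set_option linter.dupNamespace false
set_option linter.style.longLine false

noncomputable section

open scoped Manifold ContDiff Topology
open CategoryTheory Limits Function Set
open Literature.AlgebraicTopology.SingularHomology
open Literature.Topology.FourManifolds Literature.Topology.FourManifolds.MMSW

namespace Summit.SmoothPoincare4.SmoothPoincare4.Theorems.DcrGap.MkFriends

/-- **`H₂(X; ℤ) = 0` for the friends carrier, given finite-dimensionality of `H_q(ℝ⁴ | D_k; ℚ)`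
(`q = 2, 3`)** — the `H₂`-leaf of the Manolescu–Piccirillo disc-exterior swap lifted to
`∂D_k = #ᵏ(S¹ × S²)` (Manolescu–Piccirillo 2023, §3.2, proof of Lemma 3.3), by the Euler-characteristic
count of the module docstring: the long exact sequence of `(X, j(E))`, the relative Mayer–Vietoris
counts `FriendsH2.carrierCount` (in `X`) and `FriendsH2.sphereCount` (in `S⁴`), `H₃(X; ℚ) = H₁(X; ℚ) = 0`
and freeness of `H₂(X; ℤ)` for closed simply connected `4`-manifolds.
[cite: ManolescuPiccirillo2023, §3.2, proof of Lemma 3.3] [cite: HatcherAT2002, Thm. 2.16 and Thm. 3.30]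
[cite: Kirby1989, Ch. II §1] -/
theorem helper_friendsH2_of_modelHandlebody_localHomology_finite : (∀ k : ℕ, Module.Finite ℚ (Literature.AlgebraicTopology.SingularHomology.localHomologyOfSet ℚ ℚ (EuclideanSpace ℝ (Fin 4)) (Literature.Topology.FourManifolds.MMSW.modelHandlebody k) 2) ∧ Module.Finite ℚ (Literature.AlgebraicTopology.SingularHomology.localHomologyOfSet ℚ ℚ (EuclideanSpace ℝ (Fin 4)) (Literature.Topology.FourManifolds.MMSW.modelHandlebody k) 3)) → ∀ (k : ℕ) (K₀ K₁ : (Metric.sphere (0 : EuclideanSpace ℝ (Fin 2)) 1) → EuclideanSpace ℝ (Fin 4)) (f₁ : EuclideanSpace ℝ (Fin 2) → EuclideanSpace ℝ (Fin 4)), Literature.Topology.FourManifolds.MMSW.IsModelKnot k K₀ → Literature.Topology.FourManifolds.MMSW.IsNullHomologous k K₀ → Literature.Topology.FourManifolds.MMSW.IsModelKnot k K₁ → Literature.Topology.FourManifolds.MMSW.IsNullHomologous k K₁ → Literature.Topology.FourManifolds.MMSW.IsModelSliceDisc k K₁ f₁ → ∀ (X : Type) [TopologicalSpace X] [T2Space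 X] [SecondCountableTopology X] [ChartedSpace (EuclideanSpace ℝ (Fin 4)) X] [IsManifold (𝓡 4) ((⊤ : ℕ∞) : WithTop ℕ∞) X] [CompactSpace X] (U : Set (EuclideanSpace ℝ (Fin 4))) (i : EuclideanSpace ℝ (Fin 4) → X) (f₀ : EuclideanSpace ℝ (Fin 2) → X) (g₀ : EuclideanSpace ℝ (Fin 2) → EuclideanSpace ℝ (Fin 4)) (E : TopologicalSpace.Opens (EuclideanSpace ℝ (Fin 4))) (j : E → X) (q : X), (IsOpen U ∧ Literature.Topology.FourManifolds.MMSW.modelHandlebody k ⊆ U ∧ ContMDiffOn (𝓡 4) (𝓡 4) ((⊤ : ℕ∞) : WithTop ℕ∞) i U ∧ Set.InjOn i U ∧ (∀ x ∈ U, Function.Injective (mfderiv (𝓡 4) (𝓡 4) i x))) → (ContMDiff (𝓡 2) (𝓡 4) ((⊤ : ℕ∞) : WithTop ℕ∞) f₀ ∧ Set.InjOn f₀ (Metric.closedBall (0 : EuclideanSpace ℝ (Fin 2)) 1) ∧ (∀ x ∈ Metric.closedBall (0 : EuclideanSpace ℝ (Fin 2)) 1, Function.Injective (mfderiv (𝓡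 2) (𝓡 4) f₀ x)) ∧ (∀ x : EuclideanSpace ℝ (Fin 2), ‖x‖ < 1 → f₀ x ∉ i '' Literature.Topology.FourManifolds.MMSW.modelHandlebody k) ∧ (∀ t : (Metric.sphere (0 : EuclideanSpace ℝ (Fin 2)) 1), f₀ t = i (K₀ t)) ∧ ContDiff ℝ ((⊤ : ℕ∞) : WithTop ℕ∞) g₀ ∧ (∃ η : ℝ, 0 < η ∧ (∀ x : EuclideanSpace ℝ (Fin 2), 1 - η < ‖x‖ → ‖x‖ ≤ 1 → g₀ x ∈ U ∧ f₀ x = i (g₀ x))) ∧ (∀ t : (Metric.sphere (0 : EuclideanSpace ℝ (Fin 2)) 1), deriv (fun ρ : ℝ => Literature.Topology.FourManifolds.MMSW.levelFun k (g₀ (ρ • (t : EuclideanSpace ℝ (Fin 2))))) 1 < 0)) → (((E : Set (EuclideanSpace ℝ (Fin 4))) = {x | x ∉ Literature.Topology.FourManifolds.MMSW.modelHandlebody k ∧ x ∉ f₁ '' Metric.closedBall (0 : EuclideanSpace ℝ (Fin 2)) 1}) ∧ Manifold.IsSmoothEmbedding (𝓡 4) (𝓡 4) ((⊤ : ℕ∞)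 : WithTop ℕ∞) j ∧ IsOpen (Set.range j) ∧ Set.range j = (i '' Literature.Topology.FourManifolds.MMSW.modelHandlebody k ∪ f₀ '' Metric.closedBall (0 : EuclideanSpace ℝ (Fin 2)) 1 ∪ {q})ᶜ ∧ (∀ s ∈ nhds q, ∃ R : ℝ, ∀ a : E, R < ‖(a : EuclideanSpace ℝ (Fin 4))‖ → j a ∈ s)) → SimplyConnectedSpace X → CategoryTheory.Limits.IsZero (Literature.Topology.FourManifolds.singularHomologyZ X 2) := by
  intro hHF k K₀ K₁ f₁ hK₀ _ hK₁ _ hf₁ X _ _ _ _ _ _ U i f₀ g₀ E j q hgerm hcore hext hsc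
  obtain ⟨hU, hDU, hi, hinj, hd⟩ := hgerm
  obtain ⟨hf₀, hf₀inj, hf₀d, hf₀out, hf₀K, -, -, -⟩ := hcore
  obtain ⟨hE, hj, -, hrange, -⟩ := hext
  haveI := hsc
  haveI : Module.Finite ℚ (localHomologyOfSet ℚ ℚ (EuclideanSpace ℝ (Fin 4)) (modelHandlebody k) 2) :=
    (hHF k).1
  haveI : Module.Finite ℚ (localHomologyOfSet ℚ ℚ (EuclideanSpace ℝ (Fin 4)) (modelHandlebody k) 3) :=
    (hHF k).2
  -- the two relative counts
  obtain ⟨hX3, hX2, hXc⟩ := FriendsH2.carrierCount hK₀ q hU hDU hi hinj hd hf₀ hf₀inj hf₀d hf₀out hf₀K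
  obtain ⟨hE2, hE1, hEc⟩ := FriendsH2.sphereCount hK₁ hf₁ hE
  -- `X ∖ C⁺ = j(E) ≅ E`
  set C : Set X := i '' modelHandlebody k ∪ f₀ '' Metric.closedBall (0 : EuclideanSpace ℝ (Fin 2)) 1 ∪ {q}
    with hC
  have hS : Cᶜ = range j := hrange.symm
  have Θ : (↥(E : Set (EuclideanSpace ℝ (Fin 4)))) ≃ₜ ↥(Cᶜ) :=
    hj.isEmbedding.toHomeomorph.trans (Homeomorph.setCongr hS.symm)
  haveI := hE2
  haveI := hE1
  haveI : Module.Finite ℚ (singularHomology ℚ ℚ ↥(Cᶜ) 2) :=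
    Module.Finite.equiv (singularHomology.xEquiv ℚ ℚ Θ 2)
  haveI : Module.Finite ℚ (singularHomology ℚ ℚ ↥(Cᶜ) 1) :=
    Module.Finite.equiv (singularHomology.xEquiv ℚ ℚ Θ 1)
  haveI : Module.Finite ℚ (relativeSingularHomology ℚ ℚ X Cᶜ 3) := hX3
  haveI : Module.Finite ℚ (relativeSingularHomology ℚ ℚ X Cᶜ 2) := hX2
  -- `H₃(X; ℚ) = H₁(X; ℚ) = 0`
  obtain ⟨μ⟩ := isOrientableOver_of_simplyConnectedSpace ℤ X (n := 4)
  have h3 : IsZero (singularHomology ℚ ℚ X 3) :=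
    isZero_singularHomology_rat X (isZero_singularHomology_three_of_simplyConnectedSpace μ)
  have h1 : IsZero (singularHomology ℚ ℚ X 1) :=
    isZero_singularHomology_one_of_simplyConnectedSpace ℚ ℚ (X := X)
  -- the count along the long exact sequence of `(X, X ∖ C⁺)`
  obtain ⟨-, hb⟩ := FriendsH2.lesCount (Cᶜ) h3 h1
  have e2 := (singularHomology.xEquiv ℚ ℚ Θ 2).finrank_eq
  have e1 := (singularHomology.xEquiv ℚ ℚ Θ 1).finrank_eq
  have r3 : Module.finrank ℚ (relativeSingularHomology ℚ ℚ X Cᶜ 3) =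
      Module.finrank ℚ (localHomologyOfSet ℚ ℚ X C 3) := rfl
  have r2 : Module.finrank ℚ (relativeSingularHomology ℚ ℚ X Cᶜ 2) =
      Module.finrank ℚ (localHomologyOfSet ℚ ℚ X C 2) := rfl
  have hb0 : Module.finrank ℚ (singularHomology ℚ ℚ X 2) = 0 := by
    have : (Module.finrank ℚ (singularHomology ℚ ℚ X 2) : ℤ) = 0 := by
      rw [hb, r3, r2, ← e2, ← e1]
      linarith
    exact_mod_cast this
  -- `H₂(X; ℤ)` is free of rank `b₂(X) = 0`
  change IsZero (singularHomology ℤ ℤ X 2)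
  refine isZero_singularHomology_two_of_finrank_eq_zero μ ?_
  rw [(finrank_singularHomology_two_eq_of_simplyConnectedSpace X).2]
  exact hb0

end Summit.SmoothPoincare4.SmoothPoincare4.Theorems.DcrGap.MkFriends

end
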